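import Summits.QuantumFields.BalabanUV.Beta.FP.PackedLawFullIndex

/-!
# `BalabanUV.Beta.FP.PackedLawFullIndexGraded` — road «FP» for binder row D1, ROUTE T, RULING R-FP-80 (J-RISK-2′): **THE DOOR's SECOND-ORDER SLOT IS
# PARITY-BLIND** — the `kkt` slot reads the GRADED-EVEN PART of any full-index second-order table, and the graded-odd part is dead weight in `hessT`
# against a graded-even chart; so #26's one-system transfer holds with the border-parity row `hWt` REPLACED by the chart's own parity `hAσ`

WHY.  #26 `PackedLawFullIndex` turns the door's `kkt`-shaped second-order block into the `D_σ`-twisted restriction of a full-index `Ŵ` under TWO letters: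
`Ŵ|μμ = 0` on `range fμ` (`hWm`) and the ANTISYMMETRIC field∕multiplier twin `Ŵ (b̃, fμ a) = −Ŵ (fμ a, b̃)` (`hWt`; the wrapper's `hWNt ∕ hWFt ∕ hWGt`).
Engine C's by-value reading R-FP-39-WNTWIN (2026-08-27, `ttrl/balaban-calc/wntwin/WNTWIN.md`) of the (III′) literal's `W2SymOfK` at depth 1 is «MIXED»: its
word `vertex2OfK T₂` has the anti-twin border, its response word `dM (K2OfK …) N S M` (built on the FIRST-order, graded-odd tables `S, M`) the symmetric twin —
so `hWt` is not inhabited by the literal as displayed.  THIS FILE removes the letter.  Write `s := Sum.elim 1 (−1)` on the fibre `Fib d = Fin (d+1) ⊕ Fin (d+1)`;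
call a full-index matrix `X` GRADED-EVEN if `X p q = s p.2 · s q.2 · X q p` (ff∕μμ symmetric, border anti-twin) and GRADED-ODD if `X p q = −s p.2 · s q.2 · X q p`.
§1 the graded-even part `Ŵ♮ p q := ½(Ŵ p q + s p.2 · s q.2 · Ŵ q p)` (written out, no `def`): its blocks (`ff`: `½(Ŵ + Ŵᵀ)`; `μf`: `½(Ŵ_μf − Ŵ_fμᵀ)`; anti-twin
border BY CONSTRUCTION; `μμ`), graded-even, `= Ŵ` when `Ŵ` is graded-even; §1b `perF M K` is graded-even as soon as the lattice kernel is (`K x y a b =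
s a · s b · K y x b a`) and is `M`-invariant (`KernelPeriodisationFib.perF_transpose` + `perF_scaleK_apply`) — the discharger of the new letter for a chart;
§2 over ANY finite index with an involutive sign: `tr(A·X) = 0` for `A` graded-even, `X` graded-odd; **`tr(A·X♮) = tr(A·X)`** and **`hessT A V V′ X♮ = hessT A V V′ X`**
for graded-even `A` (`hessT = ½(tr(LW) − tr(LV·LV′))`: the bubble has no `W`); §3 **(W♮) `kkt (Ŵ♮|ff) (Ŵ♮|μf) = (Ŵ♮·D_σ).submatrix e♯ e♯`** under `hWm` ALONE
(#26 (W) at `Ŵ♮`); §4 **`hessT_packedLeg_evenBlocks_eq_perF`** — #26 §2b's one-system lemma with the second-order blocks those of `Ŵ♮`, hypotheses `hWm` + the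
chart parity **`hAσ : ∀ p q, perF M A p q = s p.2 · s q.2 · perF M A q p`** INSTEAD OF `hWt`, and the conclusion `= hessT (perF M A) V V′ Ŵ` on the ORIGINAL `Ŵ`;
`_letters` form with the blocks DISPLAYED (`hH₂ : H₂ = Matrix.of (b b′ ↦ ½(Ŵ b̃ b̃′ + Ŵ b̃′ b̃))`, `hQ₂ : Q₂ = Matrix.of (a b ↦ ½(Ŵ (fμ a) b̃ − Ŵ b̃ (fμ a)))`).
READING (zero weight): the chart kernels ARE graded-even (`KInv = D_σ·(𝕄D_σ)⁻¹` for the symmetric `𝕄D_σ` of lit `SecondOrderResponse`'s typed Lagrangian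
chart; an2 g45 (L0) `perF_GcombSh_border_antitwin` is the border face; the one-shot charts' `XN = D_σ·Â` of the wrapper's `hLN` are symmetric KKT inverses);
for the literal §2 is Engine C DG22-1's «the `dM K2OfK` word vanishes identically in the second moment» extended to the border.  Whether the colour-stripped
literal SHOULD carry a graded-even response word is the (T-ID)∕(P6) identification — NOT adjudicated here.
[folklore] finite block∕trace bookkeeping; no `def`, no `def … : Prop`, nothing cited, 0 sorry; 0 estimates.  NOT HERE: the v4 wrapper (its rows `hHN₂ ∕ hQN₂`
restated against `Ŵ♮`, `hWNt ∕ hWFt ∕ hWGt` dropped, `hAσ_X` displayed), the three-system socket variant, any discharge of `hAσ` at the record.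

HONEST DEPENDENCY (page 1, mandatory): continuum YM on T⁴ ⇐ BetaPertH ∧ nine spine estimates (0/9 proved); BetaPertH ⇐ (D1) ∧ (D4) ∧ CAP+tail;
G-an2-4 gates asym, D1 and NE2/3/4.  HONEST FRAMING (cell contract, verbatim): «discharging `BetaPertH` makes Bałaban's UV stability UNCONDITIONAL —
a real constructive-QFT result; it is NOT the continuum limit and NOT the Clay problem.»  ABSOLUTE RULE (cell charter, verbatim): «No internally-minted
statement may enter as a cited fact. Every hypothesis is either kernel-proved in this package or a verbatim quotation of a PUBLISHED theorem with page
reference. The manuscript(s) under audit are NOT citable for their own disputed steps — they are the thing under adjudication; programme-internal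
(2001/route/tribunal) claims are never citable.»  Nothing of the dictionary's identification ∕ Bałaban's asserted; the parities and the packed law are
HYPOTHESES here; 0∕4 row-D1 binders (hW, hR, D1Tel, D1Rep); NOT (T-ID), NOT SDF, NOT D1, NOT BetaPertH, NOT continuum, NOT Clay.  Road «FP» OWNER,
b2b-balaban-beta-d1-p3 gen 40, 2026-08-27.  No existing file touched.
-/

noncomputable section

open scoped BigOperators Matrix

namespace Summit.QuantumFields.BalabanUV.Beta.FP.PackedLawFullIndexGraded

open Matrix
open Literature.Probability.LatticeModels (Torus.proj)
open Literature.MathematicalPhysics.QuantumFieldTheory.Balaban1983to89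
open Literature.MathematicalPhysics.QuantumFieldTheory.Balaban1983to89.Beta
open Literature.MathematicalPhysics.QuantumFieldTheory.Balaban1983to89.Beta.Composition (kkt)
open B4TorusKernel.MultiPeriod (translate)
open B6Lemma24Torus (pbox)
open ExpKernelCalculus (MKer)
open HessKerRate (scaleK scaleK_apply)
open AffineAveraging (Site)
open OneStepResolventKernel (Fib)
open Summit.QuantumFields.BalabanUV.Beta.AxialDressingRooted (axEc)
open Summit.QuantumFields.BalabanUV.Beta.D1BFx.MixedVarPackedHess (hessT)
open Summit.QuantumFields.BalabanUV.Beta.FP.KernelPeriodisationFib (Idx perF trF perF_transpose perF_scaleK_apply)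
open Summit.QuantumFields.BalabanUV.Beta.FP.PackedLawFullIndex (signFib_fμ kkt_blocks_eq_signTwist_submatrix hessT_packedLeg_blocks_eq_perF)

/-! ## §2 (placed first: index-generic) Traces against a graded-even matrix see only the graded-even part -/

section Trace

variable {ι : Type*} [Fintype ι] (sg : ι → ℝ)

/-- [folklore] **`trace_mul_eq_zero_of_graded`**: for an involutive sign `sg` (`sg i · sg i = 1`), a GRADED-EVEN `A` (`A p q = sg p · sg q · A q p`) and a GRADED-ODD `X`
(`X p q = −(sg p · sg q · X q p)`): `tr(A·X) = 0` (it equals its own negative: `tr(A X) = tr((A D)(D X))`, symmetric × antisymmetric). -/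
theorem trace_mul_eq_zero_of_graded (hsg : ∀ i, sg i * sg i = 1) (A X : Matrix ι ι ℝ)
    (hA : ∀ p q, A p q = sg p * sg q * A q p) (hX : ∀ p q, X p q = -(sg p * sg q * X q p)) : (A * X).trace = 0 := by
  have h : (A * X).trace = -(A * X).trace := by
    calc (A * X).trace = ∑ p, ∑ q, A p q * X q p := by simp only [Matrix.trace, Matrix.diag, Matrix.mul_apply]
      _ = ∑ p, ∑ q, -(A q p * X p q) := by
          refine Finset.sum_congr rfl fun p _ => Finset.sum_congr rfl fun q _ => ?_
          rw [hA p q, hX q p]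
          have hp := hsg p; have hq := hsg q
          linear_combination (-(A q p * X p q * sg q * sg q)) * hp - (A q p * X p q) * hq
      _ = -∑ q, ∑ p, A q p * X p q := by rw [Finset.sum_comm]; simp only [Finset.sum_neg_distrib]
      _ = -(A * X).trace := by simp only [Matrix.trace, Matrix.diag, Matrix.mul_apply]
  linarith

/-- [folklore] **`trace_mul_evenPart`**: against a GRADED-EVEN `A`, the trace of `A·X` sees only the graded-even part `X♮ p q := ½(X p q + sg p · sg q · X q p)`:
`tr(A·X♮) = tr(A·X)` (re-indexing; no involutivity needed). -/
theorem trace_mul_evenPart (A X : Matrix ι ι ℝ) (hA : ∀ p q, A p q = sg p * sg q * A q p) :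
    (A * Matrix.of fun p q : ι => (1 / 2 : ℝ) * (X p q + sg p * sg q * X q p)).trace = (A * X).trace := by
  have h1 : ∑ p, ∑ q, A p q * (sg q * sg p * X p q) = ∑ p, ∑ q, A p q * X q p := by
    calc ∑ p, ∑ q, A p q * (sg q * sg p * X p q) = ∑ p, ∑ q, A q p * X p q := by
          refine Finset.sum_congr rfl fun p _ => Finset.sum_congr rfl fun q _ => ?_
          rw [hA q p]; ring
      _ = ∑ q, ∑ p, A q p * X p q := Finset.sum_comm
      _ = ∑ p, ∑ q, A p q * X q p := rfl
  simp only [Matrix.trace, Matrix.diag, Matrix.mul_apply, Matrix.of_apply]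
  have h2 : ∀ p q, A p q * (1 / 2 * (X q p + sg q * sg p * X p q)) = (1 / 2) * (A p q * X q p) + (1 / 2) * (A p q * (sg q * sg p * X p q)) :=
    fun p q => by ring
  simp only [h2, Finset.sum_add_distrib, ← Finset.mul_sum, h1]
  ring

/-- [folklore] **`hessT_evenPart` — THE GRADED-ODD PART OF THE SECOND-ORDER TABLE IS DEAD WEIGHT IN `hessT`**: for a graded-even leg `A`,
`hessT A V V′ X♮ = hessT A V V′ X` (`hessT = ½(tr(A W) − tr(A V·A V′))`; the bubble does not see `W`). -/
theorem hessT_evenPart (A V V' X : Matrix ι ι ℝ) (hA : ∀ p q, A p q = sg p * sg q * A q p) :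
    hessT A V V' (Matrix.of fun p q : ι => (1 / 2 : ℝ) * (X p q + sg p * sg q * X q p)) = hessT A V V' X := by
  unfold hessT
  rw [trace_mul_evenPart sg A X hA]

omit [Fintype ι] in
/-- [folklore] the graded-even part is graded-even (for an involutive sign). -/
theorem evenPart_gradedEven (hsg : ∀ i, sg i * sg i = 1) (X : Matrix ι ι ℝ) (p q : ι) :
    (Matrix.of fun p q : ι => (1 / 2 : ℝ) * (X p q + sg p * sg q * X q p)) p q
      = sg p * sg q * (Matrix.of fun p q : ι => (1 / 2 : ℝ) * (X p q + sg p * sg q * X q p)) q p := by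
  simp only [Matrix.of_apply]
  have hp := hsg p; have hq := hsg q
  linear_combination (-(1 / 2 : ℝ) * X p q * sg q * sg q) * hp - ((1 / 2 : ℝ) * X p q) * hq

omit [Fintype ι] in
/-- [folklore] a graded-even matrix IS its graded-even part (for an involutive sign). -/
theorem evenPart_eq_self_of_gradedEven (hsg : ∀ i, sg i * sg i = 1) (X : Matrix ι ι ℝ) (hX : ∀ p q, X p q = sg p * sg q * X q p) :
    (Matrix.of fun p q : ι => (1 / 2 : ℝ) * (X p q + sg p * sg q * X q p)) = X := by
  ext p q
  simp only [Matrix.of_apply]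
  rw [hX q p]
  have hp := hsg p; have hq := hsg q
  linear_combination ((1 / 2 : ℝ) * X p q * sg q * sg q) * hp + ((1 / 2 : ℝ) * X p q) * hq

end Trace

/-! ## §1 The graded-even part on the fibred torus index: blocks -/

section Blocks

variable {d : ℕ} (M : Fin (d + 1) → ℕ)

/-- [folklore] the fibre sign is involutive. -/
theorem signFib_mul_self (c : Fib d) :
    Sum.elim (fun _ : Fin (d + 1) => (1 : ℝ)) (fun _ : Fin (d + 1) => (-1 : ℝ)) c
      * Sum.elim (fun _ : Fin (d + 1) => (1 : ℝ)) (fun _ : Fin (d + 1) => (-1 : ℝ)) c = 1 := by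
  rcases c with α | m <;> simp

/-- [folklore] the `ff` block of the graded-even part is the symmetrised `ff` block: `X♮ (b̃, b̃′) = ½(X b̃ b̃′ + X b̃′ b̃)`. -/
theorem evenPart_inl_inl (X : Matrix (Idx M (Fib d)) (Idx M (Fib d)) ℝ) (x y : ↥(pbox M)) (α β : Fin (d + 1)) :
    (Matrix.of fun p q : Idx M (Fib d) => (1 / 2 : ℝ) * (X p q
        + Sum.elim (fun _ : Fin (d + 1) => (1 : ℝ)) (fun _ : Fin (d + 1) => (-1 : ℝ)) p.2
          * Sum.elim (fun _ : Fin (d + 1) => (1 : ℝ)) (fun _ : Fin (d + 1) => (-1 : ℝ)) q.2 * X q p)) (x, Sum.inl α) (y, Sum.inl β)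
      = (1 / 2 : ℝ) * (X (x, Sum.inl α) (y, Sum.inl β) + X (y, Sum.inl β) (x, Sum.inl α)) := by
  simp only [Matrix.of_apply, Sum.elim_inl, one_mul]

/-- [folklore] the `μf` block of the graded-even part: `X♮ ((x, inr m), b̃) = ½(X ((x, inr m), b̃) − X (b̃, (x, inr m)))`. -/
theorem evenPart_inr_inl (X : Matrix (Idx M (Fib d)) (Idx M (Fib d)) ℝ) (x y : ↥(pbox M)) (m β : Fin (d + 1)) :
    (Matrix.of fun p q : Idx M (Fib d) => (1 / 2 : ℝ) * (X p q
        + Sum.elim (fun _ : Fin (d + 1) => (1 : ℝ)) (fun _ : Fin (d + 1) => (-1 : ℝ)) p.2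
          * Sum.elim (fun _ : Fin (d + 1) => (1 : ℝ)) (fun _ : Fin (d + 1) => (-1 : ℝ)) q.2 * X q p)) (x, Sum.inr m) (y, Sum.inl β)
      = (1 / 2 : ℝ) * (X (x, Sum.inr m) (y, Sum.inl β) - X (y, Sum.inl β) (x, Sum.inr m)) := by
  simp only [Matrix.of_apply, Sum.elim_inl, Sum.elim_inr, mul_one, neg_mul, one_mul, sub_eq_add_neg]

/-- [folklore] the `fμ` block of the graded-even part: `X♮ (b̃, (y, inr m)) = ½(X (b̃, (y, inr m)) − X ((y, inr m), b̃))`. -/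
theorem evenPart_inl_inr (X : Matrix (Idx M (Fib d)) (Idx M (Fib d)) ℝ) (x y : ↥(pbox M)) (α m : Fin (d + 1)) :
    (Matrix.of fun p q : Idx M (Fib d) => (1 / 2 : ℝ) * (X p q
        + Sum.elim (fun _ : Fin (d + 1) => (1 : ℝ)) (fun _ : Fin (d + 1) => (-1 : ℝ)) p.2
          * Sum.elim (fun _ : Fin (d + 1) => (1 : ℝ)) (fun _ : Fin (d + 1) => (-1 : ℝ)) q.2 * X q p)) (x, Sum.inl α) (y, Sum.inr m)
      = (1 / 2 : ℝ) * (X (x, Sum.inl α) (y, Sum.inr m) - X (y, Sum.inr m) (x, Sum.inl α)) := by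
  simp only [Matrix.of_apply, Sum.elim_inl, Sum.elim_inr, one_mul, neg_mul, sub_eq_add_neg]

/-- [folklore] the `μμ` block of the graded-even part is the symmetrised `μμ` block. -/
theorem evenPart_inr_inr (X : Matrix (Idx M (Fib d)) (Idx M (Fib d)) ℝ) (x y : ↥(pbox M)) (m m' : Fin (d + 1)) :
    (Matrix.of fun p q : Idx M (Fib d) => (1 / 2 : ℝ) * (X p q
        + Sum.elim (fun _ : Fin (d + 1) => (1 : ℝ)) (fun _ : Fin (d + 1) => (-1 : ℝ)) p.2
          * Sum.elim (fun _ : Fin (d + 1) => (1 : ℝ)) (fun _ : Fin (d + 1) => (-1 : ℝ)) q.2 * X q p)) (x, Sum.inr m) (y, Sum.inr m')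
      = (1 / 2 : ℝ) * (X (x, Sum.inr m) (y, Sum.inr m') + X (y, Sum.inr m') (x, Sum.inr m)) := by
  simp only [Matrix.of_apply, Sum.elim_inr, mul_neg, mul_one, neg_neg, one_mul]

/-- [folklore] **`evenPart_antitwin` — THE BORDER OF THE GRADED-EVEN PART IS ANTI-TWIN BY CONSTRUCTION**: `X♮ (b̃, c̃) = −X♮ (c̃, b̃)` for a field index `b̃` and a
multiplier index `c̃` — the shape of the wrapper's `hWNt`, now a theorem about `X♮` for ANY `X`. -/
theorem evenPart_antitwin (X : Matrix (Idx M (Fib d)) (Idx M (Fib d)) ℝ) (x y : ↥(pbox M)) (α m : Fin (d + 1)) :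
    (Matrix.of fun p q : Idx M (Fib d) => (1 / 2 : ℝ) * (X p q
        + Sum.elim (fun _ : Fin (d + 1) => (1 : ℝ)) (fun _ : Fin (d + 1) => (-1 : ℝ)) p.2
          * Sum.elim (fun _ : Fin (d + 1) => (1 : ℝ)) (fun _ : Fin (d + 1) => (-1 : ℝ)) q.2 * X q p)) (x, Sum.inl α) (y, Sum.inr m)
      = -(Matrix.of fun p q : Idx M (Fib d) => (1 / 2 : ℝ) * (X p q
        + Sum.elim (fun _ : Fin (d + 1) => (1 : ℝ)) (fun _ : Fin (d + 1) => (-1 : ℝ)) p.2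
          * Sum.elim (fun _ : Fin (d + 1) => (1 : ℝ)) (fun _ : Fin (d + 1) => (-1 : ℝ)) q.2 * X q p)) (y, Sum.inr m) (x, Sum.inl α) := by
  rw [evenPart_inl_inr, evenPart_inr_inl]; ring

variable {μ : Type*} (fμ : μ → Idx M (Fib d))

/-- [folklore] the `ff` restriction of the graded-even part along the packing injection, DISPLAYED: `X♮.sub e_F e_F = Matrix.of (b b′ ↦ ½(X b̃ b̃′ + X b̃′ b̃))`. -/
theorem evenPart_submatrix_ff (X : Matrix (Idx M (Fib d)) (Idx M (Fib d)) ℝ) :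
    (Matrix.of fun p q : Idx M (Fib d) => (1 / 2 : ℝ) * (X p q
        + Sum.elim (fun _ : Fin (d + 1) => (1 : ℝ)) (fun _ : Fin (d + 1) => (-1 : ℝ)) p.2
          * Sum.elim (fun _ : Fin (d + 1) => (1 : ℝ)) (fun _ : Fin (d + 1) => (-1 : ℝ)) q.2 * X q p)).submatrix
        (fun b : ↥(pbox M) × Fin (d + 1) => ((b.1, Sum.inl b.2) : Idx M (Fib d)))
        (fun b : ↥(pbox M) × Fin (d + 1) => ((b.1, Sum.inl b.2) : Idx M (Fib d)))
      = Matrix.of fun b b' : ↥(pbox M) × Fin (d + 1) =>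
          (1 / 2 : ℝ) * (X (b.1, Sum.inl b.2) (b'.1, Sum.inl b'.2) + X (b'.1, Sum.inl b'.2) (b.1, Sum.inl b.2)) := by
  ext b b'
  simp only [Matrix.submatrix_apply, Matrix.of_apply, Sum.elim_inl, one_mul]

/-- [folklore] the `μf` restriction of the graded-even part along a MULTIPLIER-valued packing injection, DISPLAYED:
`X♮.sub fμ e_F = Matrix.of (a b ↦ ½(X (fμ a) b̃ − X b̃ (fμ a)))`. -/
theorem evenPart_submatrix_μf (hμ : ∀ a : μ, ∃ m : Fin (d + 1), (fμ a).2 = Sum.inr m) (X : Matrix (Idx M (Fib d)) (Idx M (Fib d)) ℝ) :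
    (Matrix.of fun p q : Idx M (Fib d) => (1 / 2 : ℝ) * (X p q
        + Sum.elim (fun _ : Fin (d + 1) => (1 : ℝ)) (fun _ : Fin (d + 1) => (-1 : ℝ)) p.2
          * Sum.elim (fun _ : Fin (d + 1) => (1 : ℝ)) (fun _ : Fin (d + 1) => (-1 : ℝ)) q.2 * X q p)).submatrix fμ
        (fun b : ↥(pbox M) × Fin (d + 1) => ((b.1, Sum.inl b.2) : Idx M (Fib d)))
      = Matrix.of fun (a : μ) (b : ↥(pbox M) × Fin (d + 1)) =>
          (1 / 2 : ℝ) * (X (fμ a) (b.1, Sum.inl b.2) - X (b.1, Sum.inl b.2) (fμ a)) := by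
  have hσ := signFib_fμ M fμ hμ
  ext a b
  simp only [Matrix.submatrix_apply, Matrix.of_apply, Sum.elim_inl, hσ, mul_one, neg_mul, one_mul, sub_eq_add_neg]

end Blocks

/-! ## §1b A chart is graded-even on the torus as soon as its lattice kernel is -/

section Chart

variable {d : ℕ} (M : Fin (d + 1) → ℕ)

/-- [folklore] **`perF_gradedEven_of_kernel`** — THE DISCHARGER OF THE CHART-PARITY LETTER `hAσ`: if the lattice kernel is graded-symmetric,
`K x y a b = s a · s b · K y x b a`, and `M`-invariant, then `perF M K p q = s p.2 · s q.2 · perF M K q p` (`K = scaleK s s (trF K)`;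
`KernelPeriodisationFib.perF_scaleK_apply` + `perF_transpose`). -/
theorem perF_gradedEven_of_kernel {K : MKer (d + 1) (Fib d)}
    (hKσ : ∀ (x y : Fin (d + 1) → ℤ) (a b : Fib d), K x y a b
      = Sum.elim (fun _ : Fin (d + 1) => (1 : ℝ)) (fun _ : Fin (d + 1) => (-1 : ℝ)) a
        * Sum.elim (fun _ : Fin (d + 1) => (1 : ℝ)) (fun _ : Fin (d + 1) => (-1 : ℝ)) b * K y x b a)
    (hK : ∀ (m x y : Fin (d + 1) → ℤ) (a b : Fib d), K (translate M x m) (translate M y m) a b = K x y a b) (p q : Idx M (Fib d)) :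
    perF M K p q
      = Sum.elim (fun _ : Fin (d + 1) => (1 : ℝ)) (fun _ : Fin (d + 1) => (-1 : ℝ)) p.2
        * Sum.elim (fun _ : Fin (d + 1) => (1 : ℝ)) (fun _ : Fin (d + 1) => (-1 : ℝ)) q.2 * perF M K q p := by
  have hKe : K = scaleK (Sum.elim (fun _ : Fin (d + 1) => (1 : ℝ)) (fun _ : Fin (d + 1) => (-1 : ℝ)))
      (Sum.elim (fun _ : Fin (d + 1) => (1 : ℝ)) (fun _ : Fin (d + 1) => (-1 : ℝ))) (trF K) := by
    funext x y a b
    rw [scaleK_apply, hKσ x y a b]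
    simp only [trF]
    ring
  conv_lhs => rw [hKe]
  rw [perF_scaleK_apply, perF_transpose M hK, Matrix.transpose_apply]
  ring

end Chart

/-! ## §3 (W♮): the `kkt` block of the graded-even part is its twisted restriction — NO parity letter on `Ŵ` -/

section BlocksW

variable {d : ℕ} (M : Fin (d + 1) → ℕ)
variable {μ : Type*} (fμ : μ → Idx M (Fib d))

/-- [folklore] the graded-even part of a `μμ`-free table is `μμ`-free on `range fμ`. -/
theorem evenPart_mm (X : Matrix (Idx M (Fib d)) (Idx M (Fib d)) ℝ) (hmm : ∀ a a' : μ, X (fμ a) (fμ a') = 0) (a a' : μ) :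
    (Matrix.of fun p q : Idx M (Fib d) => (1 / 2 : ℝ) * (X p q
        + Sum.elim (fun _ : Fin (d + 1) => (1 : ℝ)) (fun _ : Fin (d + 1) => (-1 : ℝ)) p.2
          * Sum.elim (fun _ : Fin (d + 1) => (1 : ℝ)) (fun _ : Fin (d + 1) => (-1 : ℝ)) q.2 * X q p)) (fμ a) (fμ a') = 0 := by
  simp only [Matrix.of_apply, hmm, mul_zero, add_zero]

/-- [folklore] the graded-even part has the anti-twin along a multiplier-valued packing injection (the `hWt` letter of #26, as a theorem). -/
theorem evenPart_antitwin_fμ (hμ : ∀ a : μ, ∃ m : Fin (d + 1), (fμ a).2 = Sum.inr m) (X : Matrix (Idx M (Fib d)) (Idx M (Fib d)) ℝ)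
    (b : ↥(pbox M) × Fin (d + 1)) (a : μ) :
    (Matrix.of fun p q : Idx M (Fib d) => (1 / 2 : ℝ) * (X p q
        + Sum.elim (fun _ : Fin (d + 1) => (1 : ℝ)) (fun _ : Fin (d + 1) => (-1 : ℝ)) p.2
          * Sum.elim (fun _ : Fin (d + 1) => (1 : ℝ)) (fun _ : Fin (d + 1) => (-1 : ℝ)) q.2 * X q p)) (b.1, Sum.inl b.2) (fμ a)
      = -(Matrix.of fun p q : Idx M (Fib d) => (1 / 2 : ℝ) * (X p q
        + Sum.elim (fun _ : Fin (d + 1) => (1 : ℝ)) (fun _ : Fin (d + 1) => (-1 : ℝ)) p.2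
          * Sum.elim (fun _ : Fin (d + 1) => (1 : ℝ)) (fun _ : Fin (d + 1) => (-1 : ℝ)) q.2 * X q p)) (fμ a) (b.1, Sum.inl b.2) := by
  have hσ := signFib_fμ M fμ hμ
  simp only [Matrix.of_apply, Sum.elim_inl, hσ, one_mul, mul_one, neg_mul]
  ring

/-- [folklore] **(W♮) `kkt_evenBlocks_eq_signTwist_submatrix`** — #26 (W) with NO parity hypothesis on `Ŵ`: for ANY full-index `Ŵ` that is `μμ`-free on `range fμ`,
`kkt (Ŵ♮.sub e_F e_F) (Ŵ♮.sub fμ e_F) = (Ŵ♮ · D_σ).submatrix e♯ e♯`. -/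
theorem kkt_evenBlocks_eq_signTwist_submatrix (hμ : ∀ a : μ, ∃ m : Fin (d + 1), (fμ a).2 = Sum.inr m)
    (X : Matrix (Idx M (Fib d)) (Idx M (Fib d)) ℝ) (hmm : ∀ a a' : μ, X (fμ a) (fμ a') = 0) :
    kkt ((Matrix.of fun p q : Idx M (Fib d) => (1 / 2 : ℝ) * (X p q
          + Sum.elim (fun _ : Fin (d + 1) => (1 : ℝ)) (fun _ : Fin (d + 1) => (-1 : ℝ)) p.2
            * Sum.elim (fun _ : Fin (d + 1) => (1 : ℝ)) (fun _ : Fin (d + 1) => (-1 : ℝ)) q.2 * X q p)).submatrix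
            (fun b : ↥(pbox M) × Fin (d + 1) => ((b.1, Sum.inl b.2) : Idx M (Fib d)))
            (fun b : ↥(pbox M) × Fin (d + 1) => ((b.1, Sum.inl b.2) : Idx M (Fib d))))
        ((Matrix.of fun p q : Idx M (Fib d) => (1 / 2 : ℝ) * (X p q
          + Sum.elim (fun _ : Fin (d + 1) => (1 : ℝ)) (fun _ : Fin (d + 1) => (-1 : ℝ)) p.2
            * Sum.elim (fun _ : Fin (d + 1) => (1 : ℝ)) (fun _ : Fin (d + 1) => (-1 : ℝ)) q.2 * X q p)).submatrix fμ
            (fun b : ↥(pbox M) × Fin (d + 1) => ((b.1, Sum.inl b.2) : Idx M (Fib d))))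
      = ((Matrix.of fun p q : Idx M (Fib d) => (1 / 2 : ℝ) * (X p q
          + Sum.elim (fun _ : Fin (d + 1) => (1 : ℝ)) (fun _ : Fin (d + 1) => (-1 : ℝ)) p.2
            * Sum.elim (fun _ : Fin (d + 1) => (1 : ℝ)) (fun _ : Fin (d + 1) => (-1 : ℝ)) q.2 * X q p))
          * Matrix.diagonal (fun p : Idx M (Fib d) => Sum.elim (fun _ : Fin (d + 1) => (1 : ℝ)) (fun _ : Fin (d + 1) => (-1 : ℝ)) p.2)).submatrix
          (Sum.elim (fun b : ↥(pbox M) × Fin (d + 1) => ((b.1, Sum.inl b.2) : Idx M (Fib d))) fμ)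
          (Sum.elim (fun b : ↥(pbox M) × Fin (d + 1) => ((b.1, Sum.inl b.2) : Idx M (Fib d))) fμ) :=
  kkt_blocks_eq_signTwist_submatrix M fμ hμ _ (evenPart_mm M fμ X hmm) (evenPart_antitwin_fμ M fμ hμ X)

end BlocksW

/-! ## §4 One system across, parity-blind: the packed leg against the graded first-order blocks and the `kkt` block of `Ŵ♮` IS `hessT (perF M A) V V′ Ŵ` -/

section OneSystem

variable {d : ℕ} (ρ : Fin (d + 1) → ℤ) (Lc : ℕ) (M : Fin (d + 1) → ℕ) [∀ μ, NeZero (M μ)]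
variable {μ : Type*} [Fintype μ] (fμ : μ → Idx M (Fib d))

variable {Lc} in
/-- [folklore] **`hessT_packedLeg_evenBlocks_eq_perF` — ONE SYSTEM ACROSS, PARITY-BLIND (R-FP-80).**  #26 §2b `hessT_packedLeg_blocks_eq_perF` with the
second-order blocks those of the graded-even part `Ŵ♮` and the border-parity letter `hWt` REPLACED by the chart's parity `hAσ` («`perF M A` is graded-even»):
for a chart kernel `A` under the torus rules, full-index first jets `V V′` (`μμ`-free, SYMMETRIC twin — unchanged) and ANY `Ŵ` that is `μμ`-free on `range fμ`,
`hessT (packed leg) (graded V) (graded V′) (kkt (Ŵ♮|ff) (Ŵ♮|μf)) = hessT (perF M A) V V′ Ŵ` — on the ORIGINAL `Ŵ` (§3 + #26 §2b at `Ŵ♮` + §2 `hessT_evenPart`). -/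
theorem hessT_packedLeg_evenBlocks_eq_perF (hfμ : Function.Injective fμ) (hμ : ∀ a : μ, ∃ m : Fin (d + 1), (fμ a).2 = Sum.inr m)
    (hcoarse : ∀ (s : ↥(pbox M)) (m : Fin (d + 1)), ((s, Sum.inr m) : Idx M (Fib d)) ∈ Set.range fμ ↔ Torus.proj Lc (s : Site (d + 1)) = 0)
    {A : MKer (d + 1) (Fib d)} (hEA : perF M (axEc ρ Lc) * perF M A = perF M A) (hAE : perF M A * perF M (axEc ρ Lc) = perF M A)
    (hAσ : ∀ p q : Idx M (Fib d), perF M A p q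
      = Sum.elim (fun _ : Fin (d + 1) => (1 : ℝ)) (fun _ : Fin (d + 1) => (-1 : ℝ)) p.2
        * Sum.elim (fun _ : Fin (d + 1) => (1 : ℝ)) (fun _ : Fin (d + 1) => (-1 : ℝ)) q.2 * perF M A q p)
    (V V' W : Matrix (Idx M (Fib d)) (Idx M (Fib d)) ℝ)
    (hVm : ∀ a a' : μ, V (fμ a) (fμ a') = 0) (hVt : ∀ (b : ↥(pbox M) × Fin (d + 1)) (a : μ), V (b.1, Sum.inl b.2) (fμ a) = V (fμ a) (b.1, Sum.inl b.2))
    (hV'm : ∀ a a' : μ, V' (fμ a) (fμ a') = 0) (hV't : ∀ (b : ↥(pbox M) × Fin (d + 1)) (a : μ), V' (b.1, Sum.inl b.2) (fμ a) = V' (fμ a) (b.1, Sum.inl b.2))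
    (hWm : ∀ a a' : μ, W (fμ a) (fμ a') = 0) :
    hessT
        (fromBlocks
          (Matrix.of fun (b b' : ↥(pbox M) × Fin (d + 1)) =>
            axEc ρ Lc (b.1 : Site (d + 1)) (b.1 : Site (d + 1)) (Sum.inl b.2) (Sum.inl b.2)
              * (axEc ρ Lc (b'.1 : Site (d + 1)) (b'.1 : Site (d + 1)) (Sum.inl b'.2) (Sum.inl b'.2) * perF M A (b.1, Sum.inl b.2) (b'.1, Sum.inl b'.2)))
          (Matrix.of fun (b : ↥(pbox M) × Fin (d + 1)) (a : μ) =>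
            axEc ρ Lc (b.1 : Site (d + 1)) (b.1 : Site (d + 1)) (Sum.inl b.2) (Sum.inl b.2) * perF M A (b.1, Sum.inl b.2) (fμ a))
          (-Matrix.of fun (a : μ) (b : ↥(pbox M) × Fin (d + 1)) =>
            axEc ρ Lc (b.1 : Site (d + 1)) (b.1 : Site (d + 1)) (Sum.inl b.2) (Sum.inl b.2) * perF M A (fμ a) (b.1, Sum.inl b.2))
          (-((perF M A).submatrix fμ fμ)))
        (fromBlocks
          (V.submatrix (fun b : ↥(pbox M) × Fin (d + 1) => ((b.1, Sum.inl b.2) : Idx M (Fib d)))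
            (fun b : ↥(pbox M) × Fin (d + 1) => ((b.1, Sum.inl b.2) : Idx M (Fib d))))
          (-(V.submatrix fμ (fun b : ↥(pbox M) × Fin (d + 1) => ((b.1, Sum.inl b.2) : Idx M (Fib d))))ᵀ)
          (V.submatrix fμ (fun b : ↥(pbox M) × Fin (d + 1) => ((b.1, Sum.inl b.2) : Idx M (Fib d)))) 0)
        (fromBlocks
          (V'.submatrix (fun b : ↥(pbox M) × Fin (d + 1) => ((b.1, Sum.inl b.2) : Idx M (Fib d)))
            (fun b : ↥(pbox M) × Fin (d + 1) => ((b.1, Sum.inl b.2) : Idx M (Fib d))))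
          (-(V'.submatrix fμ (fun b : ↥(pbox M) × Fin (d + 1) => ((b.1, Sum.inl b.2) : Idx M (Fib d))))ᵀ)
          (V'.submatrix fμ (fun b : ↥(pbox M) × Fin (d + 1) => ((b.1, Sum.inl b.2) : Idx M (Fib d)))) 0)
        (kkt
          ((Matrix.of fun p q : Idx M (Fib d) => (1 / 2 : ℝ) * (W p q
            + Sum.elim (fun _ : Fin (d + 1) => (1 : ℝ)) (fun _ : Fin (d + 1) => (-1 : ℝ)) p.2
              * Sum.elim (fun _ : Fin (d + 1) => (1 : ℝ)) (fun _ : Fin (d + 1) => (-1 : ℝ)) q.2 * W q p)).submatrix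
              (fun b : ↥(pbox M) × Fin (d + 1) => ((b.1, Sum.inl b.2) : Idx M (Fib d)))
              (fun b : ↥(pbox M) × Fin (d + 1) => ((b.1, Sum.inl b.2) : Idx M (Fib d))))
          ((Matrix.of fun p q : Idx M (Fib d) => (1 / 2 : ℝ) * (W p q
            + Sum.elim (fun _ : Fin (d + 1) => (1 : ℝ)) (fun _ : Fin (d + 1) => (-1 : ℝ)) p.2
              * Sum.elim (fun _ : Fin (d + 1) => (1 : ℝ)) (fun _ : Fin (d + 1) => (-1 : ℝ)) q.2 * W q p)).submatrix fμ
              (fun b : ↥(pbox M) × Fin (d + 1) => ((b.1, Sum.inl b.2) : Idx M (Fib d)))))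
      = hessT (perF M A) V V' W := by
  rw [hessT_packedLeg_blocks_eq_perF ρ M fμ hfμ hμ hcoarse hEA hAE V V' _ hVm hVt hV'm hV't (evenPart_mm M fμ W hWm)
    (evenPart_antitwin_fμ M fμ hμ W)]
  exact hessT_evenPart (fun p : Idx M (Fib d) => Sum.elim (fun _ : Fin (d + 1) => (1 : ℝ)) (fun _ : Fin (d + 1) => (-1 : ℝ)) p.2)
    (perF M A) V V' W hAσ

variable {Lc} in
/-- [folklore] **`hessT_packedLeg_evenBlocks_eq_perF_letters`** — the same with the door's BLOCKS DISPLAYED (the v4 wrapper's (S3-2) bindings under R-FP-80):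
`hH₁ : H₁ = V|ff`, `hQ₁ : Q₁ = V|μf`, `hH₁′`, `hQ₁′`, **`hH₂ : H₂ = Matrix.of (b b′ ↦ ½(Ŵ b̃ b̃′ + Ŵ b̃′ b̃))`**, **`hQ₂ : Q₂ = Matrix.of (a b ↦ ½(Ŵ (fμ a) b̃ − Ŵ b̃ (fμ a)))`**;
then `hessT (packed leg) (fromBlocks H₁ (−Q₁ᵀ) Q₁ 0) (fromBlocks H₁′ (−Q₁′ᵀ) Q₁′ 0) (kkt H₂ Q₂) = hessT (perF M A) V V′ Ŵ`. -/
theorem hessT_packedLeg_evenBlocks_eq_perF_letters (hfμ : Function.Injective fμ) (hμ : ∀ a : μ, ∃ m : Fin (d + 1), (fμ a).2 = Sum.inr m)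
    (hcoarse : ∀ (s : ↥(pbox M)) (m : Fin (d + 1)), ((s, Sum.inr m) : Idx M (Fib d)) ∈ Set.range fμ ↔ Torus.proj Lc (s : Site (d + 1)) = 0)
    {A : MKer (d + 1) (Fib d)} (hEA : perF M (axEc ρ Lc) * perF M A = perF M A) (hAE : perF M A * perF M (axEc ρ Lc) = perF M A)
    (hAσ : ∀ p q : Idx M (Fib d), perF M A p q
      = Sum.elim (fun _ : Fin (d + 1) => (1 : ℝ)) (fun _ : Fin (d + 1) => (-1 : ℝ)) p.2
        * Sum.elim (fun _ : Fin (d + 1) => (1 : ℝ)) (fun _ : Fin (d + 1) => (-1 : ℝ)) q.2 * perF M A q p)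
    (V V' W : Matrix (Idx M (Fib d)) (Idx M (Fib d)) ℝ)
    (hVm : ∀ a a' : μ, V (fμ a) (fμ a') = 0) (hVt : ∀ (b : ↥(pbox M) × Fin (d + 1)) (a : μ), V (b.1, Sum.inl b.2) (fμ a) = V (fμ a) (b.1, Sum.inl b.2))
    (hV'm : ∀ a a' : μ, V' (fμ a) (fμ a') = 0) (hV't : ∀ (b : ↥(pbox M) × Fin (d + 1)) (a : μ), V' (b.1, Sum.inl b.2) (fμ a) = V' (fμ a) (b.1, Sum.inl b.2))
    (hWm : ∀ a a' : μ, W (fμ a) (fμ a') = 0)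
    (L : Matrix ((↥(pbox M) × Fin (d + 1)) ⊕ μ) ((↥(pbox M) × Fin (d + 1)) ⊕ μ) ℝ)
    (hL : L = fromBlocks
      (Matrix.of fun (b b' : ↥(pbox M) × Fin (d + 1)) =>
        axEc ρ Lc (b.1 : Site (d + 1)) (b.1 : Site (d + 1)) (Sum.inl b.2) (Sum.inl b.2)
          * (axEc ρ Lc (b'.1 : Site (d + 1)) (b'.1 : Site (d + 1)) (Sum.inl b'.2) (Sum.inl b'.2) * perF M A (b.1, Sum.inl b.2) (b'.1, Sum.inl b'.2)))
      (Matrix.of fun (b : ↥(pbox M) × Fin (d + 1)) (a : μ) =>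
        axEc ρ Lc (b.1 : Site (d + 1)) (b.1 : Site (d + 1)) (Sum.inl b.2) (Sum.inl b.2) * perF M A (b.1, Sum.inl b.2) (fμ a))
      (-Matrix.of fun (a : μ) (b : ↥(pbox M) × Fin (d + 1)) =>
        axEc ρ Lc (b.1 : Site (d + 1)) (b.1 : Site (d + 1)) (Sum.inl b.2) (Sum.inl b.2) * perF M A (fμ a) (b.1, Sum.inl b.2))
      (-((perF M A).submatrix fμ fμ)))
    (H₁ H₁' H₂ : Matrix (↥(pbox M) × Fin (d + 1)) (↥(pbox M) × Fin (d + 1)) ℝ) (Q₁ Q₁' Q₂ : Matrix μ (↥(pbox M) × Fin (d + 1)) ℝ)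
    (hH₁ : H₁ = V.submatrix (fun b : ↥(pbox M) × Fin (d + 1) => ((b.1, Sum.inl b.2) : Idx M (Fib d)))
      (fun b : ↥(pbox M) × Fin (d + 1) => ((b.1, Sum.inl b.2) : Idx M (Fib d))))
    (hQ₁ : Q₁ = V.submatrix fμ (fun b : ↥(pbox M) × Fin (d + 1) => ((b.1, Sum.inl b.2) : Idx M (Fib d))))
    (hH₁' : H₁' = V'.submatrix (fun b : ↥(pbox M) × Fin (d + 1) => ((b.1, Sum.inl b.2) : Idx M (Fib d)))
      (fun b : ↥(pbox M) × Fin (d + 1) => ((b.1, Sum.inl b.2) : Idx M (Fib d))))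
    (hQ₁' : Q₁' = V'.submatrix fμ (fun b : ↥(pbox M) × Fin (d + 1) => ((b.1, Sum.inl b.2) : Idx M (Fib d))))
    (hH₂ : H₂ = Matrix.of fun b b' : ↥(pbox M) × Fin (d + 1) =>
      (1 / 2 : ℝ) * (W (b.1, Sum.inl b.2) (b'.1, Sum.inl b'.2) + W (b'.1, Sum.inl b'.2) (b.1, Sum.inl b.2)))
    (hQ₂ : Q₂ = Matrix.of fun (a : μ) (b : ↥(pbox M) × Fin (d + 1)) =>
      (1 / 2 : ℝ) * (W (fμ a) (b.1, Sum.inl b.2) - W (b.1, Sum.inl b.2) (fμ a))) :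
    hessT L (fromBlocks H₁ (-Q₁ᵀ) Q₁ 0) (fromBlocks H₁' (-Q₁'ᵀ) Q₁' 0) (kkt H₂ Q₂) = hessT (perF M A) V V' W := by
  subst hL hH₁ hQ₁ hH₁' hQ₁'
  rw [← hessT_packedLeg_evenBlocks_eq_perF ρ M fμ hfμ hμ hcoarse hEA hAE hAσ V V' W hVm hVt hV'm hV't hWm, evenPart_submatrix_ff M W,
    evenPart_submatrix_μf M fμ hμ W, hH₂, hQ₂]

end OneSystem

end Summit.QuantumFields.BalabanUV.Beta.FP.PackedLawFullIndexGraded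

end
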